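import Summits.ResolutionOfSingularities.ResolutionOfSingularities.Theorems.WeightedInvariantWeightedConstructionStaticLevers
import Summits.ResolutionOfSingularities.ResolutionOfSingularities.Theorems.WeightedInvariantWeightedConstructionExceptionalSmooth

/-!
# Static levers, II: no Φ-ray ⇔ the vertex is the strict maximum of the cone pair

Route `ResolutionOfSingularities/WeightedInvariant`, crux `WeightedConstruction`
(stmt-ResolutionOfSingularities-0571), line `no-phi-rays-static-drop` (lead c3). For a static pre-datum
`S` (Theorems/…StaticDefs.lean) and a pair `(Y, X)` under the guard, at a maximum point `y` lying in a
weighted chart `U` of the datum's OWN centre: every point `e` of the punctured cone pair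
`(E(U), X'|_{E(U)})` (the exceptional divisor of `B₊(U)`) is rated STRICTLY BELOW the vertex point `e₀`
over `y` of the full cone pair `(V(t⁻¹) ⊆ B(U), σˢ(X)|_{V(t⁻¹)})` — the cone drop `(CI)` gives
`inv e < max_Y inv = inv y`, and degeneration monotonicity (lever L5,
`StaticPreDatum.inv_le_inv_exceptional_vertex`, Theorems/…StaticLevers.lean) gives `inv y ≤ inv e₀`.
So on the weighted normal cone of its own centre a static pre-datum sees the vertex section as the exact
maximum locus: the static meaning of "no Φ-ray" (idea card `no-phi-rays-static-drop`), and the test every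
proposed centre rule must pass WITHOUT blowing up (memo `Cruxes/WeightedConstruction/STATIC-LEVERS.md`).
-/

noncomputable section

open CategoryTheory AlgebraicGeometry TopologicalSpace
open Literature.AlgebraicGeometry.Resolution
open scoped LaurentPolynomial

set_option linter.dupNamespace false -- mandated namespace of this single-conjunct summit

namespace Summit.ResolutionOfSingularities.ResolutionOfSingularities.Theorems

/-- **No Φ-ray: every point of the punctured cone pair of the datum's own centre is rated strictly below
the vertex point of the full cone pair** (registered stub `stub_inv_exceptional_lt_inv_vertex` of line
`no-phi-rays-static-drop`; `(CI)` + lever L5). [cite: Wlodarczyk2022, Thm. 4.3.1 and Lemma 4.1.5] -/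
theorem stub_inv_exceptional_lt_inv_vertex :
    ∀ {p : ℕ} (S : StaticPreDatum p) ⦃k : Type⦄ [Field k] [CharP k p] [PerfectField k]
      ⦃Y : Scheme.{0}⦄ (f : Y ⟶ Spec (.of k)) [Smooth f] [IsSeparated f] [QuasiCompact f]
      (X : Y.IdealSheafData), (∃ y : Y, ¬ IsBot (S.inv f X y)) →
      ∀ (U : Y.affineOpens),
      (∃ (m : ℕ) (u : Fin m → Γ(Y, U)) (w : Fin m → ℕ), (S.centre f X).IsWeightedChart U u w) →
      Smooth ((S.centre f X).cobordantPlusι U ≫ f) →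
      IsSeparated ((S.centre f X).cobordantPlusι U ≫ f) →
      QuasiCompact ((S.centre f X).cobordantPlusι U ≫ f) →
      ∀ (y : Y), y ∈ (U : Y.Opens) → (∀ y' : Y, S.inv f X y' ≤ S.inv f X y) →
      ∀ e : (cobordantExceptional (S.centre f X) U).subscheme,
      ∃ e₀ : (affineCobordantBlowup.exceptional ((S.centre f X).chartIdeals U)).subscheme,
        ((affineCobordantBlowup.exceptional ((S.centre f X).chartIdeals U)).subschemeι ≫
            affineCobordantBlowup.π ((S.centre f X).chartIdeals U) ≫ U.2.fromSpec) e₀ = y ∧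
        (affineCobordantBlowup.exceptional ((S.centre f X).chartIdeals U)).subschemeι e₀ ∈
          ((affineCobordantBlowup.vertex ((S.centre f X).chartIdeals U)).support :
            Set (affineCobordantBlowup ((S.centre f X).chartIdeals U))) ∧
        S.inv ((cobordantExceptional (S.centre f X) U).subschemeι ≫ (S.centre f X).cobordantPlusι U ≫ f)
            (((S.centre f X).cobordantStrictTransform U X).comap
              (cobordantExceptional (S.centre f X) U).subschemeι) e <
          S.inv ((affineCobordantBlowup.exceptional ((S.centre f X).chartIdeals U)).subschemeι ≫
              affineCobordantBlowup.π ((S.centre f X).chartIdeals U) ≫ U.2.fromSpec ≫ f)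
            ((affineCobordantBlowup.idealSheaf ((S.centre f X).chartIdeals U)
                (extReesAlgebra.strictTransform ((S.centre f X).chartIdeals U) (X.ideal U))).comap
              (affineCobordantBlowup.exceptional ((S.centre f X).chartIdeals U)).subschemeι) e₀ := by
  intro p S k _ _ _ Y f _ _ _ X hguard U hchart hsm hsep hqc y hyU hy e
  -- `y` is a point of the centre: the support of the centre is the maximum locus
  have hyC : y ∈ (S.centre f X).support := by
    rw [S.support_centre f X hguard]
    exact hy
  -- lever L5 at `y`: the vertex point `e₀` of the full cone pair dominates `y`
  obtain ⟨e₀, he₀y, he₀v, hle⟩ :=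
    S.inv_le_inv_exceptional_vertex f X (S.centre f X) U hchart y hyU hyC
  -- `(CI)` at `e`: the punctured cone pair is strictly below `max_Y inv = inv y`
  haveI := hsm
  haveI := hsep
  haveI := hqc
  have hEsm : Smooth ((cobordantExceptional (S.centre f X) U).subschemeι ≫
      (S.centre f X).cobordantPlusι U ≫ f) :=
    stub_exceptional_smooth f (S.centre f X) U hchart hsm
  have hEsep : IsSeparated ((cobordantExceptional (S.centre f X) U).subschemeι ≫
      (S.centre f X).cobordantPlusι U ≫ f) := inferInstance
  have hEqc : QuasiCompact ((cobordantExceptional (S.centre f X) U).subschemeι ≫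
      (S.centre f X).cobordantPlusι U ≫ f) := inferInstance
  have hlt := S.inv_exceptional_lt f X hguard U hchart hsm hsep hqc hEsm hEsep hEqc e y hy
  exact ⟨e₀, he₀y, he₀v, hlt.trans_le hle⟩

end Summit.ResolutionOfSingularities.ResolutionOfSingularities.Theorems

end
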